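import Summits.Ventures.HodgeRepro2.T6B1Carriers

/-!
# T6B1Fields — (B1.a), the standing fields, in kernel (Tier-6 sub-goal B1, proof lane)

TIER4 B1.1: for a CM field `F` (Liu's `E`; Mathlib's `NumberField.IsCMField F`) with maximal totally real subfield
`F⁺ = maximalRealSubfield F` (Liu's `F`), complex conjugation `c = IsCMField.complexConj F`:
* `[F⁺ : ℚ] · 2 = [F : ℚ]`, so `[F : ℚ] = 6` gives `d = [F⁺ : ℚ] = 3`; `Φ_{F⁺} = InfinitePlace F⁺` has `d` elements
  and `Σ = Hom(F, ℂ)` has `2d`; every embedding `φ` of `F` satisfies `φ ∘ c = conj ∘ φ` and `φ ≠ conj ∘ φ`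
  (the fibres `{τ, τ̄}` of `π`);
* O'Meara's datum: there is `θ ∈ F⁺`, a non-square, negative at every real place of `F⁺`, with
  `F ≃ₐ[F⁺] F⁺(√θ) = QuadraticAlgebra F⁺ θ 0` — the bridge between the host's CM field and the carriers of
  `T6B1Carriers` (`Ext K θ`); `θ = t²` for any `c`-anti-invariant `t ≠ 0`.
-/

namespace Summit.Ventures.HodgeRepro2.T6
namespace B1Fields

open NumberField B1Carriers

variable (F : Type*) [Field F] [NumberField F] [IsCMField F]

/-! ## Degrees and places -/

/-- `[F⁺ : ℚ] · 2 = [F : ℚ]`. -/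
theorem finrank_maximalRealSubfield_mul_two : Module.finrank ℚ (maximalRealSubfield F) * 2 = Module.finrank ℚ F := by
  rw [← Algebra.IsQuadraticExtension.finrank_eq_two (maximalRealSubfield F) F, Module.finrank_mul_finrank ℚ (maximalRealSubfield F) F]

/-- `[F : ℚ] = 6` gives `d = [F⁺ : ℚ] = 3`. -/
theorem finrank_eq_three (h6 : Module.finrank ℚ F = 6) : Module.finrank ℚ (maximalRealSubfield F) = 3 := by
  have := finrank_maximalRealSubfield_mul_two F
  omega

omit [IsCMField F] in
/-- `Φ_{F⁺}` has `d = [F⁺ : ℚ]` elements (every place of the totally real `F⁺` is real). -/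
theorem card_infinitePlace_maximalRealSubfield :
    Fintype.card (InfinitePlace (maximalRealSubfield F)) = Module.finrank ℚ (maximalRealSubfield F) := by
  rw [InfinitePlace.card_eq_nrRealPlaces_add_nrComplexPlaces, IsTotallyReal.nrComplexPlaces_eq_zero, add_zero,
    IsTotallyReal.finrank]

/-- `[F : ℚ] = 6` gives three real places of `F⁺`. -/
theorem card_infinitePlace_eq_three (h6 : Module.finrank ℚ F = 6) : Fintype.card (InfinitePlace (maximalRealSubfield F)) = 3 := by
  rw [card_infinitePlace_maximalRealSubfield, finrank_eq_three F h6]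

omit [IsCMField F] in
/-- `Σ = Hom(F, ℂ)` has `[F : ℚ]` elements, `6` in the sextic case. -/
theorem card_embeddings (h6 : Module.finrank ℚ F = 6) : Fintype.card (F →+* ℂ) = 6 := by
  rw [Embeddings.card, h6]

/-- Every complex embedding of `F` intertwines `c` with complex conjugation: `φ ∘ c = conj ∘ φ`. -/
theorem embedding_comp_complexConj (φ : F →+* ℂ) (x : F) :
    φ (IsCMField.complexConj F x) = starRingEnd ℂ (φ x) :=
  IsCMField.complexEmbedding_complexConj F φ x

/-- No complex embedding of `F` is real: `conj ∘ φ ≠ φ`, so the two embeddings `τ, τ̄ = τ ∘ c` above a real place of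
`F⁺` are distinct. -/
theorem conj_comp_ne (φ : F →+* ℂ) : (starRingEnd ℂ).comp φ ≠ φ :=
  IsTotallyComplex.complexEmbedding_not_isReal φ

/-! ## O'Meara's datum `θ`, `E = F⁺(√θ)` -/

/-- There is a non-zero `c`-anti-invariant element of `F`. -/
theorem exists_anti_invariant : ∃ t : F, t ≠ 0 ∧ IsCMField.complexConj F t = -t := by
  obtain ⟨y, hy⟩ : ∃ y : F, IsCMField.complexConj F y ≠ y := by
    by_contra h
    apply IsCMField.complexConj_ne_one F
    ext x
    exact by_contra fun hx => h ⟨x, hx⟩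
  refine ⟨y - IsCMField.complexConj F y, sub_ne_zero.2 (Ne.symm hy), ?_⟩
  rw [map_sub, IsCMField.complexConj_apply_apply]
  ring

/-- The square of a `c`-anti-invariant element lies in `F⁺`. -/
theorem sq_mem_maximalRealSubfield {t : F} (ht : IsCMField.complexConj F t = -t) : t * t ∈ (maximalRealSubfield F) := by
  rw [← IsCMField.complexConj_eq_self_iff, map_mul, ht]
  ring

/-- A non-zero `c`-anti-invariant element does not lie in `F⁺`. -/
theorem anti_invariant_notMem {t : F} (ht0 : t ≠ 0) (ht : IsCMField.complexConj F t = -t) : t ∉ (maximalRealSubfield F) := by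
  intro hmem
  rw [← IsCMField.complexConj_eq_self_iff] at hmem
  rw [ht] at hmem
  have : (2 : F) * t = 0 := by linear_combination -hmem
  rcases mul_eq_zero.1 this with h | h
  · exact two_ne_zero h
  · exact ht0 h

/-- `θ := t²` is a non-square in `F⁺` for a non-zero `c`-anti-invariant `t`. -/
theorem not_isSquare_sq {t : F} (ht0 : t ≠ 0) (ht : IsCMField.complexConj F t = -t) :
    ¬ IsSquare (⟨t * t, sq_mem_maximalRealSubfield F ht⟩ : (maximalRealSubfield F)) := by
  rintro ⟨s, hs⟩
  have hs' : t * t = (s : F) * (s : F) := by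
    have := congrArg (fun x : (maximalRealSubfield F) => (x : F)) hs
    simpa using this
  have : (t - s) * (t + s) = 0 := by linear_combination hs'
  rcases mul_eq_zero.1 this with h | h
  · exact anti_invariant_notMem F ht0 ht (by rw [sub_eq_zero.1 h]; exact s.2)
  · exact anti_invariant_notMem F ht0 ht (by rw [eq_neg_of_add_eq_zero_left h]; exact (maximalRealSubfield F).neg_mem s.2)

/-- The `F⁺`-algebra map `F⁺(√θ) → F`, `ω ↦ t`, for `θ = t²`. -/
def toF {t : F} (ht : IsCMField.complexConj F t = -t) :
    QuadraticAlgebra (maximalRealSubfield F) (⟨t * t, sq_mem_maximalRealSubfield F ht⟩ : (maximalRealSubfield F)) 0 →ₐ[(maximalRealSubfield F)] F :=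
  QuadraticAlgebra.lift ⟨t, by simp [Algebra.smul_def]; rfl⟩

/-- `toF ⟨x, y⟩ = x + y t`. -/
theorem toF_apply {t : F} (ht : IsCMField.complexConj F t = -t)
    (z : QuadraticAlgebra (maximalRealSubfield F) (⟨t * t, sq_mem_maximalRealSubfield F ht⟩ : (maximalRealSubfield F)) 0) :
    toF F ht z = (z.re : F) + (z.im : F) * t := by
  change z.re • (1 : F) + z.im • t = _
  rw [Algebra.smul_def, Algebra.smul_def, mul_one]
  rfl

/-- `toF` is injective: `x + y t = 0` with `x, y ∈ F⁺` forces `y = 0` (else `t = −x/y ∈ F⁺`) and then `x = 0`. -/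
theorem toF_injective {t : F} (ht0 : t ≠ 0) (ht : IsCMField.complexConj F t = -t) :
    Function.Injective (toF F ht) := by
  refine (injective_iff_map_eq_zero _).2 fun z hz => ?_
  rw [toF_apply] at hz
  by_cases hy : z.im = 0
  · have hx : (z.re : F) = 0 := by simpa [hy] using hz
    refine QuadraticAlgebra.ext ?_ ?_
    · exact Subtype.ext (by simpa using hx)
    · exact hy
  · exfalso
    apply anti_invariant_notMem F ht0 ht
    have hy' : (z.im : F) ≠ 0 := by exact_mod_cast hy
    have : t = ((-z.re / z.im : (maximalRealSubfield F)) : F) := by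
      push_cast
      field_simp
      linear_combination hz
    rw [this]
    exact (-z.re / z.im : (maximalRealSubfield F)).2

/-- `toF` is an isomorphism of `F⁺`-algebras `F⁺(√θ) ≃ F` (injective between spaces of `F⁺`-dimension `2`). -/
theorem toF_bijective {t : F} (ht0 : t ≠ 0) (ht : IsCMField.complexConj F t = -t) :
    Function.Bijective (toF F ht) := by
  refine ⟨toF_injective F ht0 ht, ?_⟩
  have h := (LinearMap.injective_iff_surjective_of_finrank_eq_finrank (K := (maximalRealSubfield F)) (f := (toF F ht).toLinearMap)
    (by rw [QuadraticAlgebra.finrank_eq_two, Algebra.IsQuadraticExtension.finrank_eq_two (maximalRealSubfield F) F])).1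
    (toF_injective F ht0 ht)
  exact h

/-- **(B1.a), O'Meara's datum.** For a CM field `F` there is `θ ∈ F⁺`, a non-square with `θ = t²` for a
non-zero `c`-anti-invariant `t ∈ F`, and `F ≃ₐ[F⁺] F⁺(√θ)`; moreover every complex embedding of `F` sends `θ` to a
negative real number (`θ` is totally negative). -/
theorem exists_theta : ∃ θ : (maximalRealSubfield F), ¬ IsSquare θ ∧ (∀ φ : F →+* ℂ, (φ (θ : F)).re < 0 ∧ (φ (θ : F)).im = 0) ∧
    Nonempty (QuadraticAlgebra (maximalRealSubfield F) θ 0 ≃ₐ[(maximalRealSubfield F)] F) := by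
  obtain ⟨t, ht0, ht⟩ := exists_anti_invariant F
  refine ⟨⟨t * t, sq_mem_maximalRealSubfield F ht⟩, not_isSquare_sq F ht0 ht, fun φ => ?_,
    ⟨AlgEquiv.ofBijective (toF F ht) (toF_bijective F ht0 ht)⟩⟩
  have hφ : φ t = -starRingEnd ℂ (φ t) := by
    rw [← embedding_comp_complexConj F φ, ht, map_neg, neg_neg]
  have hre : (φ t).re = 0 := by
    have := congrArg Complex.re hφ
    simp only [Complex.neg_re, Complex.conj_re] at this
    linarith
  have hne : φ t ≠ 0 := (map_ne_zero φ).2 ht0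
  have him : (φ t).im ≠ 0 := by
    intro h
    apply hne
    exact Complex.ext hre h
  show (φ (t * t)).re < 0 ∧ (φ (t * t)).im = 0
  rw [map_mul]
  simp only [Complex.mul_re, Complex.mul_im, hre]
  constructor
  · nlinarith [sq_pos_of_ne_zero him]
  · ring


/-! ## v2 addendum: the fibres of `π : Σ → Φ_{F⁺}` (TIER4 B1.1: «π is 2-to-1 with fibres {τ, τ̄}») -/

/-- `Σ = Hom(F, ℂ)` has twice as many elements as `Hom(F⁺, ℂ)` (= `Φ_{F⁺}` for the totally real `F⁺`). -/
theorem card_embeddings_eq_two_mul :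
    Fintype.card (F →+* ℂ) = 2 * Fintype.card (maximalRealSubfield F →+* ℂ) := by
  rw [Embeddings.card, Embeddings.card, ← finrank_maximalRealSubfield_mul_two F, mul_comm]

/-- The infinite places of `F` and of `F⁺` correspond bijectively (Mathlib's `IsCMField.equivInfinitePlace`):
each real place of `F⁺` carries exactly one complex place of `F`, i.e. one conjugate pair `{τ, τ̄}`. -/
theorem card_infinitePlace_eq : Fintype.card (InfinitePlace F) = Fintype.card (InfinitePlace (maximalRealSubfield F)) :=
  (IsCMField.card_infinitePlace_eq_card_infinitePlace F).symm

end B1Fields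
end Summit.Ventures.HodgeRepro2.T6
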